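import Literature.Computability.AlgebraicComplexity.PerStabilizerMarcusMay
import Mathlib.LinearAlgebra.Matrix.Permanent
import Mathlib.LinearAlgebra.FiniteDimensional.Basic
import Mathlib.Algebra.Polynomial.BigOperators
import HarnessLib

/-!
# Discharge of `marcusMay1962_perPreserver_sandwich` (Marcus–May 1962) after Botta 1967

Topic `Literature/Computability/AlgebraicComplexity`; proofs file (theorems only, no definitions,
no named facts) accompanying `PerStabilizerMarcusMay.lean`, whose named fact
`marcusMay1962_perPreserver_sandwich` (the stabilizer of `per_n`, `n ≥ 3`, quoted in
Mulmuley–Sohoni GCT II Thm. 2.3) is PROVED here: `marcusMay1962_perPreserver_sandwich_holds`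
(at the end). We follow P. Botta, *Linear transformations that preserve the permanent*,
Proc. Amer. Math. Soc. 18 (1967) 566–569 [Botta1967], whose four-page argument re-proves
Marcus–May's theorem [MarcusMay1962, §2] without permanental compounds, in this order:

* Lemma 1 [Botta1967, Lemma 1] (= Marcus–May 1962, §3 Lemma 2): a linear permanent preserver of
  `M_n(K)` is non-singular — `MarcusMay.injective_of_permanent_eq` (our proof avoids degree
  arguments: if `T A = 0` then `per W = 0` for every `W` whose `j`-th column is `A`'s, and a
  suitable test matrix has permanent `A i j`).
* Multilinearity of the permanent in a row / column (Minc, *Permanents*, Ch. 2, Thm. 1.1(a))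
  in the "affine direction" form used by Botta: `per (X + z • A) = (1 - z) per X + z per (X + A)`
  for `A` supported on one row (`MarcusMay.permanent_add_smul_row`) or one column
  (`MarcusMay.permanent_add_smul_col`), and its transport through a bijective permanent
  preserver (`MarcusMay.affine_map_of_affine`) [Botta1967, §2, first paragraph of the proof].
* Lemma 2 [Botta1967, Lemma 2]: if `z ↦ per (X + z • A)` is affine for every `X`, then every
  `2 × 2` subpermanent of `A` vanishes — `MarcusMay.subperm_eq_zero_of_affine` (over an infinite
  integral domain; we read off the `z²`-coefficient of `per (B + z • A)` for a suitable `0/1`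
  matrix `B`; the one place where a polynomial in `z` is used).
* Lemma 3 [Botta1967, Lemma 3]: a matrix all of whose `2 × 2` subpermanents vanish is supported
  on one row, or on one column, or on a `2 × 2` block with non-zero "diagonal" —
  `MarcusMay.support_of_subperm_eq_zero` (characteristic `≠ 2`).
* §2 of [Botta1967], the Theorem: the image `T(Rᵖ)` of a row space lies in a row space or a
  column space (`MarcusMay.image_row_subset_row_or_col`; a generic vector of largest support
  decides the form of Lemma 3 uniformly, and form (2) is excluded because `Fⁿ`, `n ≥ 3`, does not
  embed in the cone `xw + yz = 0` of `F⁴` — `not_isotropic`, replacing Botta's count); rows to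
  rows forces columns to columns, `T(E_pq) = b_pq E_{σ p, τ q}` with permutations `σ, τ`, and the
  permutation matrices (`per (T P_μ) = 1`) factor `b_pq = d_p l_q` with `(∏ d)(∏ l) = 1`
  (`MarcusMay.exists_sandwich_of_rows_to_rows`); the remaining case is reduced to this one by
  `X ↦ (T X)ᵀ` (`MarcusMay.exists_sandwich_of_permanent_eq`, over any infinite field with
  `2 ≠ 0`, `n ≥ 3`).
* The discharge over `ℂ` for the index type `Fin n × Fin n` of the named fact: evaluate the
  polynomial identity `linSubst M per_n = per_n` to get a permanent preserver of `M_n(ℂ)`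
  (`marcusMay1962_perPreserver_sandwich_holds`).

Deviations from the printed proofs (all inessential): injectivity (Lemma 1) by a test matrix
instead of a degree count; the exclusion of form (2) by "two of the four linear forms determine
the point" (a variant of Botta's choice of `a` with `L_ik(a) = L_jl(a) = 0`, p. 568); the
factorisation `b_pq = d_p l_q` exactly as on p. 569 of [Botta1967] (`∏_i b_{i μ(i)} = 1` for every
permutation `μ`, then transpositions), where Marcus–May (§3, Lemma 9) use second permanental
compounds instead.

Honest framing (cell `pub-gct-max`, track T): this is classical linear algebra (1962/1967) being
formalised because GCT II Thm. 2.3 quotes it; nothing here bears on VP vs VNP or P vs NP.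
-/

open Matrix

namespace Literature.Computability.AlgebraicComplexity

namespace MarcusMay

variable {ι : Type*} [Fintype ι] [DecidableEq ι] {K : Type*} [CommRing K]

/-- A matrix with a zero column has permanent zero (every product in the defining sum has a zero
factor; multilinearity in the columns, Minc, *Permanents*, Ch. 2, Thm. 1.1(a)).
[cite: Minc1978, Ch. 2, Thm. 1.1(a)] -/
theorem permanent_eq_zero_of_col_eq_zero (W : Matrix ι ι K) (j : ι) (h : ∀ r, W r j = 0) :
    W.permanent = 0 := by
  unfold Matrix.permanent
  refine Finset.sum_eq_zero fun σ _ => ?_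
  exact Finset.prod_eq_zero (Finset.mem_univ j) (h (σ j))

omit [Fintype ι] in
/-- A permutation that agrees with `swap i j` away from `j` is `swap i j`. [folklore] -/
private theorem eq_swap_of_forall_ne {i j : ι} {σ : Equiv.Perm ι}
    (h : ∀ c, c ≠ j → σ c = Equiv.swap i j c) : σ = Equiv.swap i j := by
  ext c
  by_cases hc : c = j
  · subst hc
    -- `σ c` cannot be a value `swap i c c'` taken at some `c' ≠ c`
    set c₀ := Equiv.swap i c (σ c) with hc₀
    by_cases h0 : c₀ = c
    · -- then σ c = swap i c c
      have : Equiv.swap i c (σ c) = c := by rw [← hc₀, h0]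
      have h2 := congr_arg (Equiv.swap i c) this
      rw [Equiv.swap_apply_self] at h2
      rw [h2]
    · have h1 : σ c₀ = Equiv.swap i c c₀ := h c₀ h0
      rw [hc₀, Equiv.swap_apply_self] at h1
      exact absurd (σ.injective h1) h0
  · exact h c hc

/-- The test matrix of the injectivity argument: column `j` is `v`, every other column `c` is
the unit vector `e_{swap i j c}`; its permanent is `v i` (only `σ = swap i j` contributes).
[folklore] -/
private theorem permanent_testMatrix (i j : ι) (v : ι → K) :
    (Matrix.of fun r c => if c = j then v r else if r = Equiv.swap i j c then (1 : K) else 0).permanent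
      = v i := by
  unfold Matrix.permanent
  rw [Finset.sum_eq_single (Equiv.swap i j)]
  · rw [Finset.prod_eq_single j]
    · simp
    · intro c _ hc
      simp [hc]
    · intro h
      exact absurd (Finset.mem_univ j) h
  · intro σ _ hσ
    -- some column `c ≠ j` has `σ c ≠ swap i j c`, and there the factor vanishes
    obtain ⟨c, hcj, hc⟩ : ∃ c, c ≠ j ∧ σ c ≠ Equiv.swap i j c := by
      by_contra! hall
      exact hσ (eq_swap_of_forall_ne hall)
    refine Finset.prod_eq_zero (Finset.mem_univ c) ?_
    simp [hcj, hc]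
  · intro h
    exact absurd (Finset.mem_univ _) h

/-- **Botta's Lemma 1 / Marcus–May's Lemma 2: a permanent preserver is non-singular.** If
`T : M_n(K) → M_n(K)` is linear with `per (T X) = per X` for all `X`, then `T` is injective.
Proof (ours, degree-free): if `T A = 0` then `per (X + A) = per X` for all `X`; every matrix `W`
whose `j`-th column is the `j`-th column of `A` is `Y + A` with `Y` having a zero `j`-th column,
so `per W = per Y = 0`; the test matrix with `j`-th column `A e_j` and unit vectors elsewhere has
permanent `A i j`, whence `A = 0`. [cite: Botta1967, Lemma 1] [cite: MarcusMay1962, §3, Lemma 2] -/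
theorem injective_of_permanent_eq (T : Matrix ι ι K →ₗ[K] Matrix ι ι K)
    (hT : ∀ X, (T X).permanent = X.permanent) : Function.Injective T := by
  rw [injective_iff_map_eq_zero]
  intro A hA
  have H : ∀ X : Matrix ι ι K, (X + A).permanent = X.permanent := fun X => by
    rw [← hT (X + A), map_add, hA, add_zero, hT]
  ext i j
  have hW := permanent_testMatrix i j (fun r => A r j)
  -- `Y` := the test matrix minus `A`, with column `j` zeroed
  have hYA : (Matrix.of fun r c => if c = j then (0 : K) else
        ((if c = j then A r j else if r = Equiv.swap i j c then (1 : K) else 0) - A r c)) + A =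
      (Matrix.of fun r c => if c = j then A r j else if r = Equiv.swap i j c then (1 : K) else 0) := by
    ext r c
    by_cases hc : c = j
    · simp [hc]
    · simp [hc]
  have hY : (Matrix.of fun r c => if c = j then (0 : K) else
        ((if c = j then A r j else if r = Equiv.swap i j c then (1 : K) else 0) - A r c)).permanent = 0 :=
    permanent_eq_zero_of_col_eq_zero _ j (fun r => by simp)
  rw [Matrix.zero_apply, ← hW, ← hYA, H, hY]


/-! ### Row- and column-linearity of the permanent; affine directions

Botta's invariant is "`deg_z per (X + zA) ≤ 1` for all `X`" [Botta1967, Lemma 2]. We use the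
degree-free form: the function `z ↦ per (X + zA)` is affine, i.e.
`per (X + zA) = (1 - z) per X + z per (X + A)` for all `X` and `z` ("`A` is an affine direction").
-/

/-- Additivity of the permanent in one column (Minc, *Permanents*, Ch. 2, Thm. 1.1(a):
multilinearity). [cite: Minc1978, Ch. 2, Thm. 1.1(a)] -/
theorem permanent_updateCol_add (M : Matrix ι ι K) (j : ι) (u v : ι → K) :
    (M.updateCol j (u + v)).permanent =
      (M.updateCol j u).permanent + (M.updateCol j v).permanent := by
  simp only [Matrix.permanent, ← Finset.sum_add_distrib]
  refine Finset.sum_congr rfl fun σ _ => ?_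
  rw [← Finset.mul_prod_erase _ _ (Finset.mem_univ j), ← Finset.mul_prod_erase _ _ (Finset.mem_univ j),
    ← Finset.mul_prod_erase _ _ (Finset.mem_univ j)]
  simp only [updateCol_self, Pi.add_apply]
  have h : ∀ w : ι → K, ∏ x ∈ Finset.univ.erase j, M.updateCol j w (σ x) x =
      ∏ x ∈ Finset.univ.erase j, M (σ x) x := fun w =>
    Finset.prod_congr rfl fun x hx => by rw [updateCol_ne (Finset.ne_of_mem_erase hx)]
  rw [h, h, h, add_mul]

/-- Additivity of the permanent in one row (Minc, *Permanents*, Ch. 2, Thm. 1.1(a)).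
[cite: Minc1978, Ch. 2, Thm. 1.1(a)] -/
theorem permanent_updateRow_add (M : Matrix ι ι K) (i : ι) (u v : ι → K) :
    (M.updateRow i (u + v)).permanent =
      (M.updateRow i u).permanent + (M.updateRow i v).permanent := by
  rw [← permanent_transpose, ← updateCol_transpose, permanent_updateCol_add, updateCol_transpose,
    updateCol_transpose, permanent_transpose, permanent_transpose]

/-- A matrix supported in one row is an affine direction of the permanent:
`per (X + z·(row i := a)) = (1 - z) per X + z per (X + (row i := a))` (linearity of `per` in
row `i`). [cite: Minc1978, Ch. 2, Thm. 1.1(a)] -/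
theorem permanent_add_smul_row (X : Matrix ι ι K) (i : ι) (a : ι → K) (z : K) :
    (X + z • (0 : Matrix ι ι K).updateRow i a).permanent =
      (1 - z) * X.permanent + z * (X + (0 : Matrix ι ι K).updateRow i a).permanent := by
  have h1 : X + z • (0 : Matrix ι ι K).updateRow i a = X.updateRow i (X i + z • a) := by
    ext r c
    by_cases hr : r = i
    · subst hr; simp
    · simp [hr]
  have h2 : X + (0 : Matrix ι ι K).updateRow i a = X.updateRow i (X i + a) := by
    ext r c
    by_cases hr : r = i
    · subst hr; simp
    · simp [hr]
  rw [h1, h2, permanent_updateRow_add, permanent_updateRow_add, permanent_updateRow_smul,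
    Matrix.updateRow_eq_self]
  ring

/-- A matrix supported in one column is an affine direction of the permanent.
[cite: Minc1978, Ch. 2, Thm. 1.1(a)] -/
theorem permanent_add_smul_col (X : Matrix ι ι K) (j : ι) (a : ι → K) (z : K) :
    (X + z • (0 : Matrix ι ι K).updateCol j a).permanent =
      (1 - z) * X.permanent + z * (X + (0 : Matrix ι ι K).updateCol j a).permanent := by
  have h := permanent_add_smul_row Xᵀ j a z
  rw [← transpose_zero, updateRow_transpose, ← transpose_smul, ← transpose_add, ← transpose_add,
    permanent_transpose, permanent_transpose, permanent_transpose] at h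
  exact h

/-- Affine directions are transported by a surjective permanent preserver: if `z ↦ per (X + zA)`
is affine for every `X`, so is `z ↦ per (X + z·T A)` [Botta1967, proof of the Theorem: "deg
per (T(X) + zT(A)) ≤ 1 for all X … as X runs over M_m(F) so does T(X)"].
[cite: Botta1967, §2, proof of the Theorem] -/
theorem affine_map_of_affine (T : Matrix ι ι K →ₗ[K] Matrix ι ι K)
    (hT : ∀ X, (T X).permanent = X.permanent) (hsurj : Function.Surjective T) {A : Matrix ι ι K}
    (hA : ∀ (X : Matrix ι ι K) (z : K),
      (X + z • A).permanent = (1 - z) * X.permanent + z * (X + A).permanent)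
    (X : Matrix ι ι K) (z : K) :
    (X + z • T A).permanent = (1 - z) * X.permanent + z * (X + T A).permanent := by
  obtain ⟨X', rfl⟩ := hsurj X
  rw [← map_smul, ← map_add, hT, hA, hT, ← map_add, hT]


/-! ### Affine directions have vanishing `2 × 2` subpermanents (Botta's Lemma 2)

For `i ≠ j`, `k ≠ l` put `B := ∑_{c ∉ {k,l}} E_{ρ c, c}` for a permutation `ρ` with `ρ k = i`,
`ρ l = j` (Botta's matrix "`b_tt = 1` for `t ≠ i, j`" after a permutation of columns). Then
`per (B + zA) = z² · (A_ik A_jl + A_il A_jk) + O(z³)` while affinity gives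
`per (B + zA) = z · per (B + A)`; comparing the coefficient of `z²` (over an infinite field) gives
Botta's conclusion. This is the one place where a polynomial in `z` is used. -/

section Poly

open Polynomial

/-- The permanent commutes with ring homomorphisms (it is a polynomial in the entries).
[folklore] -/
private theorem permanent_map {L : Type*} [CommRing L] (f : K →+* L) (M : Matrix ι ι K) :
    (M.map f).permanent = f M.permanent := by
  simp [Matrix.permanent, map_sum, map_prod]

omit [Fintype ι] in
/-- Two permutations agreeing outside `{k, l}` differ by `1` or by `swap k l`. [folklore] -/
private theorem eq_or_eq_mul_swap_of_forall_ne {k l : ι} {σ ρ : Equiv.Perm ι}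
    (h : ∀ c, c ≠ k → c ≠ l → σ c = ρ c) : σ = ρ ∨ σ = ρ * Equiv.swap k l := by
  -- τ := ρ⁻¹ σ fixes every point outside {k, l}
  have hτ : ∀ c, c ≠ k → c ≠ l → (ρ⁻¹ * σ) c = c := fun c hk hl => by
    rw [Equiv.Perm.mul_apply, h c hk hl]
    simp
  -- where can `τ k` go? not to a fixed point `c ∉ {k,l}` (injectivity), so `τ k ∈ {k, l}`
  have hk : (ρ⁻¹ * σ) k = k ∨ (ρ⁻¹ * σ) k = l := by
    by_contra! hne
    have hfix := hτ ((ρ⁻¹ * σ) k) hne.1 hne.2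
    exact hne.1 ((ρ⁻¹ * σ).injective hfix)
  have hl : (ρ⁻¹ * σ) l = k ∨ (ρ⁻¹ * σ) l = l := by
    by_contra! hne
    have hfix := hτ ((ρ⁻¹ * σ) l) hne.1 hne.2
    exact hne.2 ((ρ⁻¹ * σ).injective hfix)
  by_cases hkl : k = l
  · subst hkl
    left
    have : ρ⁻¹ * σ = 1 := by
      ext c
      by_cases hc : c = k
      · subst hc; simpa [or_self] using hk
      · simpa using hτ c hc hc
    calc σ = ρ * (ρ⁻¹ * σ) := by group
      _ = ρ := by rw [this, mul_one]
  rcases hk with hkk | hkl'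
  · -- τ k = k, then τ l = l
    left
    have hll : (ρ⁻¹ * σ) l = l := by
      rcases hl with h1 | h1
      · exact absurd ((ρ⁻¹ * σ).injective (h1.trans hkk.symm)) (Ne.symm hkl)
      · exact h1
    have : ρ⁻¹ * σ = 1 := by
      ext c
      by_cases hck : c = k
      · subst hck; simpa using hkk
      by_cases hcl : c = l
      · subst hcl; simpa using hll
      · simpa using hτ c hck hcl
    calc σ = ρ * (ρ⁻¹ * σ) := by group
      _ = ρ := by rw [this, mul_one]
  · -- τ k = l, then τ l = k and τ = swap k l
    right
    have hlk : (ρ⁻¹ * σ) l = k := by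
      rcases hl with h1 | h1
      · exact h1
      · exact absurd ((ρ⁻¹ * σ).injective (h1.trans hkl'.symm)) (Ne.symm hkl)
    have : ρ⁻¹ * σ = Equiv.swap k l := by
      ext c
      by_cases hck : c = k
      · subst hck; simpa using hkl'
      by_cases hcl : c = l
      · subst hcl; simpa using hlk
      · rw [Equiv.swap_apply_of_ne_of_ne hck hcl]; simpa using hτ c hck hcl
    calc σ = ρ * (ρ⁻¹ * σ) := by group
      _ = ρ * Equiv.swap k l := by rw [this]

/-- The `z²`-coefficient of one term of `per (B + zA)` for Botta's matrix `B` (zero columns `k`,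
`l`; the graph of `ρ` elsewhere): `A (σ k) k · A (σ l) l` if `σ` agrees with `ρ` off `{k,l}`,
else `0`. [folklore] -/
private theorem coeff_two_term {k l : ι} (hkl : k ≠ l) (ρ σ : Equiv.Perm ι) (A : Matrix ι ι K) :
    (∏ c, (C (if c = k ∨ c = l then (0 : K) else if σ c = ρ c then 1 else 0) +
        X * C (A (σ c) c))).coeff 2 =
      A (σ k) k * A (σ l) l *
        (if ∀ c, c ≠ k → c ≠ l → σ c = ρ c then 1 else 0) := by
  -- split off the factors at `k` and `l`
  rw [← Finset.mul_prod_erase _ _ (Finset.mem_univ k),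
    ← Finset.mul_prod_erase _ _ (Finset.mem_erase.2 ⟨Ne.symm hkl, Finset.mem_univ l⟩)]
  simp only [true_or, or_true, if_true, map_zero, zero_add]
  -- the remaining product `R` has constant term the indicator
  set R := ∏ x ∈ (Finset.univ.erase k).erase l,
    (C (if x = k ∨ x = l then (0 : K) else if σ x = ρ x then 1 else 0) + X * C (A (σ x) x)) with hR
  have hR0 : R.coeff 0 = if ∀ c, c ≠ k → c ≠ l → σ c = ρ c then 1 else 0 := by
    rw [Polynomial.coeff_zero_eq_eval_zero, hR, Polynomial.eval_prod]
    simp only [Polynomial.eval_add, Polynomial.eval_C, Polynomial.eval_mul, Polynomial.eval_X,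
      zero_mul, add_zero]
    by_cases hall : ∀ c, c ≠ k → c ≠ l → σ c = ρ c
    · rw [if_pos hall]
      refine Finset.prod_eq_one fun x hx => ?_
      simp only [Finset.mem_erase, Finset.mem_univ, and_true] at hx
      simp [hx.1, hx.2, hall x hx.2 hx.1]
    · rw [if_neg hall]
      push Not at hall
      obtain ⟨c, hck, hcl, hc⟩ := hall
      exact Finset.prod_eq_zero (Finset.mem_erase.2 ⟨hcl, Finset.mem_erase.2 ⟨hck, Finset.mem_univ c⟩⟩)
        (by simp [hck, hcl, hc])
  have hx2 : X * C (A (σ k) k) * (X * C (A (σ l) l) * R) =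
      X ^ 2 * (C (A (σ k) k * A (σ l) l) * R) := by
    rw [map_mul]; ring
  rw [hx2, show (2 : ℕ) = 0 + 2 from rfl, Polynomial.coeff_X_pow_mul, Polynomial.coeff_C_mul, hR0]

/-- **Botta's Lemma 2 (degree-free form).** If `z ↦ per (X + zA)` is affine for every `X`, then
every `2 × 2` subpermanent `A_ik A_jl + A_il A_jk` (`i ≠ j`, `k ≠ l`) of `A` vanishes. Proof as
in [Botta1967]: against the matrix `B` with ones at `(ρ c, c)`, `c ∉ {k,l}` (`ρ k = i`, `ρ l = j`)
the coefficient of `z²` in `per (B + zA)` is that subpermanent, and an affine polynomial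
function over an infinite field has no `z²` term. [cite: Botta1967, Lemma 2] -/
theorem subperm_eq_zero_of_affine [IsDomain K] [Infinite K] {A : Matrix ι ι K}
    (hA : ∀ (X : Matrix ι ι K) (z : K),
      (X + z • A).permanent = (1 - z) * X.permanent + z * (X + A).permanent)
    {i j k l : ι} (hij : i ≠ j) (hkl : k ≠ l) :
    A i k * A j l + A i l * A j k = 0 := by
  classical
  -- a permutation with `ρ k = i`, `ρ l = j`
  set ρ : Equiv.Perm ι := Equiv.swap j (Equiv.swap i k l) * Equiv.swap i k with hρ
  have hil : Equiv.swap i k l ≠ i := by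
    intro h
    have : Equiv.swap i k l = Equiv.swap i k k := by rw [h, Equiv.swap_apply_right]
    exact hkl ((Equiv.swap i k).injective this).symm
  have hρk : ρ k = i := by
    rw [hρ, Equiv.Perm.mul_apply, Equiv.swap_apply_right,
      Equiv.swap_apply_of_ne_of_ne hij (Ne.symm hil)]
  have hρl : ρ l = j := by
    rw [hρ, Equiv.Perm.mul_apply, Equiv.swap_apply_right]
  -- Botta's matrix
  set B : Matrix ι ι K :=
    Matrix.of fun r c => if c = k ∨ c = l then (0 : K) else if r = ρ c then 1 else 0 with hB
  have hB0 : B.permanent = 0 :=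
    permanent_eq_zero_of_col_eq_zero B k (fun r => by simp [hB])
  have haff : ∀ z : K, (B + z • A).permanent = z * (B + A).permanent := fun z => by
    rw [hA, hB0]; ring
  -- the polynomial `P(z) = per (B + zA)`
  set P : K[X] := (Matrix.of fun r c => C (B r c) + X * C (A r c)).permanent with hP
  have hev : ∀ z : K, P.eval z = (B + z • A).permanent := fun z => by
    rw [hP, ← Polynomial.coe_evalRingHom, ← permanent_map]
    congr 1
    ext r c
    simp [Matrix.map_apply, Matrix.add_apply, Matrix.smul_apply]
    ring
  have hPX : P = C ((B + A).permanent) * X := Polynomial.funext fun z => by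
    rw [hev, haff, Polynomial.eval_mul, Polynomial.eval_C, Polynomial.eval_X, mul_comm]
  have hc2 : P.coeff 2 = 0 := by
    rw [hPX, Polynomial.coeff_C_mul, Polynomial.coeff_X, if_neg (by norm_num), mul_zero]
  -- the direct computation of the coefficient of `z²`
  have hterm : ∀ σ : Equiv.Perm ι,
      (∏ c, (C (B (σ c) c) + X * C (A (σ c) c))).coeff 2 =
        A (σ k) k * A (σ l) l * (if ∀ c, c ≠ k → c ≠ l → σ c = ρ c then 1 else 0) := by
    intro σ
    have hBσ : ∀ c, B (σ c) c = if c = k ∨ c = l then 0 else if σ c = ρ c then 1 else 0 :=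
      fun c => by simp [hB]
    simp_rw [hBσ]
    exact coeff_two_term hkl ρ σ A
  have hc2' : P.coeff 2 = A i k * A j l + A i l * A j k := by
    rw [hP]
    unfold Matrix.permanent
    rw [Polynomial.finsetSum_coeff]
    simp only [Matrix.of_apply]
    rw [Finset.sum_congr rfl (fun σ _ => hterm σ)]
    have hne : ρ ≠ ρ * Equiv.swap k l := by
      intro h
      have h1 : Equiv.swap k l = 1 := by
        have := congr_arg (fun τ => ρ⁻¹ * τ) h
        simpa using this.symm
      exact hkl (Equiv.swap_eq_one_iff.1 h1)
    rw [Finset.sum_eq_add ρ (ρ * Equiv.swap k l) hne]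
    · have h1 : (∀ c, c ≠ k → c ≠ l → ρ c = ρ c) := fun c _ _ => rfl
      have h2 : (∀ c, c ≠ k → c ≠ l → (ρ * Equiv.swap k l) c = ρ c) := fun c hk hl => by
        rw [Equiv.Perm.mul_apply, Equiv.swap_apply_of_ne_of_ne hk hl]
      have e1 : (ρ * Equiv.swap k l) k = j := by
        rw [Equiv.Perm.mul_apply, Equiv.swap_apply_left, hρl]
      have e2 : (ρ * Equiv.swap k l) l = i := by
        rw [Equiv.Perm.mul_apply, Equiv.swap_apply_right, hρk]
      rw [if_pos h1, if_pos h2, e1, e2, hρk, hρl]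
      ring
    · intro σ _ hσ
      rw [if_neg, mul_zero]
      intro hall
      rcases eq_or_eq_mul_swap_of_forall_ne hall with h | h
      · exact hσ.1 h
      · exact hσ.2 h
    · intro h; exact absurd (Finset.mem_univ _) h
    · intro h; exact absurd (Finset.mem_univ _) h
  rw [← hc2', hc2]

end Poly

/-! ### The structure of matrices all of whose `2 × 2` subpermanents vanish (Botta's Lemma 3) -/

/-- **Botta's Lemma 3.** Over an integral domain with `2 ≠ 0`: if every `2 × 2` subpermanent
`A_ik A_jl + A_il A_jk` (`i ≠ j`, `k ≠ l`) of `A` vanishes, then either `A` is supported in a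
single row, or in a single column, or ("form (2)") there are rows `i ≠ j` and columns `k ≠ l` with
`A_ik, A_jl ≠ 0` such that every non-zero entry of `A` lies in the block `{i,j} × {k,l}` (and then
all four block entries are non-zero and the block permanent vanishes). [cite: Botta1967, Lemma 3] -/
theorem support_of_subperm_eq_zero [Nonempty ι] [IsDomain K] (h2 : (2 : K) ≠ 0) {A : Matrix ι ι K}
    (hZ : ∀ i j k l, i ≠ j → k ≠ l → A i k * A j l + A i l * A j k = 0) :
    (∃ i, ∀ r c, r ≠ i → A r c = 0) ∨ (∃ k, ∀ r c, c ≠ k → A r c = 0) ∨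
      (∃ i j k l, i ≠ j ∧ k ≠ l ∧ A i k ≠ 0 ∧ A j l ≠ 0 ∧
        ∀ r c, A r c ≠ 0 → (r = i ∨ r = j) ∧ (c = k ∨ c = l)) := by
  by_cases hex : ∃ i j k l, i ≠ j ∧ k ≠ l ∧ A i k ≠ 0 ∧ A j l ≠ 0
  · -- form (2)
    obtain ⟨i, j, k, l, hij, hkl, hik, hjl⟩ := hex
    right; right
    refine ⟨i, j, k, l, hij, hkl, hik, hjl, ?_⟩
    have h0 := hZ i j k l hij hkl
    -- the anti-diagonal entries are non-zero as well
    have hprod : A i l * A j k = -(A i k * A j l) := by linear_combination h0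
    have hil : A i l ≠ 0 := by
      intro h; rw [h, zero_mul] at hprod
      exact mul_ne_zero hik hjl (neg_eq_zero.1 hprod.symm)
    have hjk : A j k ≠ 0 := by
      intro h; rw [h, mul_zero] at hprod
      exact mul_ne_zero hik hjl (neg_eq_zero.1 hprod.symm)
    have hdet : A i k * A j l - A j k * A i l ≠ 0 := by
      have : A i k * A j l - A j k * A i l = 2 * (A i k * A j l) := by
        linear_combination (-1 : K) * h0
      rw [this]
      exact mul_ne_zero h2 (mul_ne_zero hik hjl)
    -- (a) rows outside {i, j} vanish in columns k and l
    have ha : ∀ r, r ≠ i → r ≠ j → A r l = 0 ∧ A r k = 0 := by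
      intro r hri hrj
      have e1 := hZ i r k l (Ne.symm hri) hkl
      have e2 := hZ j r k l (Ne.symm hrj) hkl
      have hl0 : A r l * (A i k * A j l - A j k * A i l) = 0 := by
        linear_combination (A j l) * e1 - (A i l) * e2
      have hrl : A r l = 0 := (mul_eq_zero.1 hl0).resolve_right hdet
      refine ⟨hrl, ?_⟩
      have : A i l * A r k = 0 := by rw [hrl, mul_zero, zero_add] at e1; exact e1
      exact (mul_eq_zero.1 this).resolve_left hil
    -- (b) columns outside {k, l} vanish in rows i and j
    have hb : ∀ c, c ≠ k → c ≠ l → A j c = 0 ∧ A i c = 0 := by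
      intro c hck hcl
      have e1 := hZ i j k c hij (Ne.symm hck)
      have e2 := hZ i j l c hij (Ne.symm hcl)
      have hj0 : A j c * (A i k * A j l - A j k * A i l) = 0 := by
        linear_combination (A j l) * e1 - (A j k) * e2
      have hjc : A j c = 0 := (mul_eq_zero.1 hj0).resolve_right hdet
      refine ⟨hjc, ?_⟩
      have : A i c * A j k = 0 := by rw [hjc, mul_zero, zero_add] at e1; exact e1
      exact (mul_eq_zero.1 this).resolve_right hjk
    intro r c hrc
    constructor
    · by_contra! hr
      obtain ⟨hri, hrj⟩ := hr
      by_cases hck : c = k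
      · exact hrc (hck ▸ (ha r hri hrj).2)
      by_cases hcl : c = l
      · exact hrc (hcl ▸ (ha r hri hrj).1)
      -- (c) r ∉ {i,j}, c ∉ {k,l}
      have e := hZ i r k c (Ne.symm hri) (Ne.symm hck)
      rw [(hb c hck hcl).2, (ha r hri hrj).2, zero_mul, add_zero] at e
      exact hrc ((mul_eq_zero.1 e).resolve_left hik)
    · by_contra! hc
      obtain ⟨hck, hcl⟩ := hc
      by_cases hri : r = i
      · exact hrc (hri ▸ (hb c hck hcl).2)
      by_cases hrj : r = j
      · exact hrc (hrj ▸ (hb c hck hcl).1)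
      have e := hZ i r k c (Ne.symm hri) (Ne.symm hck)
      rw [(hb c hck hcl).2, (ha r hri hrj).2, zero_mul, add_zero] at e
      exact hrc ((mul_eq_zero.1 e).resolve_left hik)
  · -- no two non-zero entries in distinct rows and distinct columns
    push Not at hex
    by_cases hA : ∀ r c, A r c = 0
    · left
      exact ⟨Classical.arbitrary ι, fun r c _ => hA r c⟩
    push Not at hA
    obtain ⟨i₀, k₀, h00⟩ := hA
    by_cases hrow : ∀ r c, A r c ≠ 0 → r = i₀
    · left
      exact ⟨i₀, fun r c hr => by_contra fun h => hr (hrow r c h)⟩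
    · right; left
      push Not at hrow
      obtain ⟨r₁, c₁, h11, hr₁⟩ := hrow
      have hc₁ : c₁ = k₀ := by
        by_contra hne
        exact h00 (hex r₁ i₀ c₁ k₀ hr₁ hne h11)
      refine ⟨k₀, fun r c hc => ?_⟩
      by_contra hrc
      have hr : r = i₀ := by
        by_contra hne
        exact h00 (hex r i₀ c k₀ hne hc hrc)
      subst hr
      subst hc₁
      exact hrc (hex r₁ r c₁ c hr₁ (Ne.symm hc) h11)


/-! ### Botta's §2: the image of a row space is a row space or a column space

From here on the scalars are a field `F` (infinite, `2 ≠ 0` where Lemma 2 / Lemma 3 are used).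
Row and column spaces are written without new definitions: `Rᵖ = {updateRow 0 p a}`,
`C_q = {updateCol 0 q a}`. -/

section Structure

variable {F : Type*} [Field F]

omit [Fintype ι] in
/-- The `p`-th row space is the image of a linear map `a ↦ (row p := a)`. [folklore] -/
private theorem exists_rowLinearMap (p : ι) :
    ∃ R : (ι → F) →ₗ[F] Matrix ι ι F, ∀ a, R a = (0 : Matrix ι ι F).updateRow p a := by
  refine ⟨⟨⟨fun a => (0 : Matrix ι ι F).updateRow p a, fun a b => ?_⟩, fun z a => ?_⟩,
    fun a => rfl⟩
  · ext r c
    by_cases hr : r = p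
    · subst hr; simp
    · simp [hr]
  · ext r c
    by_cases hr : r = p
    · subst hr; simp
    · simp [hr]

/-- Over an infinite field, finitely many non-zero linear functionals have a common non-zero
(a vector outside the union of finitely many hyperplanes). [folklore] -/
private theorem exists_forall_apply_ne_zero [Infinite F] {V : Type*} [AddCommGroup V]
    [Module F V] {τ : Type*} (s : Finset τ) (f : τ → V →ₗ[F] F) :
    ∃ v : V, ∀ t ∈ s, f t ≠ 0 → f t v ≠ 0 := by
  classical
  induction s using Finset.induction_on with
  | empty => exact ⟨0, fun t ht => absurd ht (Finset.notMem_empty t)⟩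
  | insert t₀ s _ ih =>
    obtain ⟨v, hv⟩ := ih
    by_cases h0 : f t₀ = 0
    · refine ⟨v, fun t ht hft => ?_⟩
      rcases Finset.mem_insert.1 ht with rfl | ht
      · exact absurd h0 hft
      · exact hv t ht hft
    · obtain ⟨b, hb⟩ : ∃ b, f t₀ b ≠ 0 := by
        by_contra h
        push Not at h
        exact h0 (LinearMap.ext h)
      -- `v + c • b` works for all but finitely many `c`
      obtain ⟨c, hc⟩ := Infinite.exists_notMem_finset
        ((insert t₀ s).image fun t => -(f t v) / f t b)
      refine ⟨v + c • b, fun t ht hft hzero => ?_⟩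
      rw [map_add, map_smul, smul_eq_mul] at hzero
      by_cases hfb : f t b = 0
      · rw [hfb, mul_zero, add_zero] at hzero
        rcases Finset.mem_insert.1 ht with rfl | ht
        · exact hb hfb
        · exact hv t ht hft hzero
      · refine hc (Finset.mem_image.2 ⟨t, ht, ?_⟩)
        rw [div_eq_iff hfb]
        linear_combination -hzero

omit [DecidableEq ι] in
/-- A "generic" parameter for a linear family of matrices: its matrix has the largest support
in the family. [folklore] -/
private theorem exists_generic_support [Infinite F] (Φ : (ι → F) →ₗ[F] Matrix ι ι F) :
    ∃ a₀ : ι → F, ∀ a r c, Φ a r c ≠ 0 → Φ a₀ r c ≠ 0 := by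
  obtain ⟨a₀, h⟩ := exists_forall_apply_ne_zero (Finset.univ : Finset (ι × ι))
    (fun rc => (Matrix.entryLinearMap F F rc.1 rc.2).comp Φ)
  refine ⟨a₀, fun a r c harc => ?_⟩
  have hne : (Matrix.entryLinearMap F F r c).comp Φ ≠ 0 := by
    intro hzero
    apply harc
    simpa using LinearMap.congr_fun hzero a
  simpa using h (r, c) (Finset.mem_univ _) hne

/-- If an injective linear map `Φ : Fⁿ → M_n(F)` takes values in the matrices supported on `n`
positions `e x` (`x : ι`), then every matrix supported there is a value of `Φ` (an injective
linear endomorphism of `Fⁿ` is surjective). [folklore] -/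
private theorem exists_eq_of_supported (Φ : (ι → F) →ₗ[F] Matrix ι ι F)
    (hΦ : Function.Injective Φ) (e : ι → ι × ι)
    (hsupp : ∀ a r c, (∀ x, e x ≠ (r, c)) → Φ a r c = 0)
    (B : Matrix ι ι F) (hB : ∀ r c, (∀ x, e x ≠ (r, c)) → B r c = 0) :
    ∃ a, Φ a = B := by
  let ψ : (ι → F) →ₗ[F] (ι → F) :=
    { toFun := fun a x => Φ a (e x).1 (e x).2
      map_add' := fun a b => by ext x; simp
      map_smul' := fun z a => by ext x; simp }
  have hψa : ∀ a x, ψ a x = Φ a (e x).1 (e x).2 := fun a x => rfl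
  have hψ : Function.Injective ψ := by
    intro a b hab
    apply hΦ
    ext r c
    by_cases hrc : ∃ x, e x = (r, c)
    · obtain ⟨x, hx⟩ := hrc
      have h := congr_fun hab x
      rw [hψa, hψa, hx] at h
      exact h
    · push Not at hrc
      rw [hsupp a r c hrc, hsupp b r c hrc]
  obtain ⟨a, ha⟩ := (LinearMap.injective_iff_surjective.1 hψ) fun x => B (e x).1 (e x).2
  refine ⟨a, ?_⟩
  ext r c
  by_cases hrc : ∃ x, e x = (r, c)
  · obtain ⟨x, hx⟩ := hrc
    have h := congr_fun ha x
    rw [hψa, hx] at h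
    exact h
  · push Not at hrc
    rw [hsupp a r c hrc, hB r c hrc]

omit [DecidableEq ι] in
/-- No `Fⁿ` with `n ≥ 3` maps injectively into `F⁴` by four linear forms `x, y, z, w` with
`x w + y z = 0` identically (a totally isotropic subspace of this quadric has dimension `≤ 2`);
this excludes Botta's "form (2)" for the image of a row space. Elementary proof: polarise, pick
`a₁ ≠ 0` with `x a₁ = y a₁ = 0` and `a₂ ≠ 0` with `z a₂ = w a₂ = 0`; the resulting linear
relations show that two of the four forms already determine the point.
[cite: Botta1967, §2, proof of the Theorem] -/
private theorem not_isotropic (hn : 3 ≤ Fintype.card ι) (x y z w : (ι → F) →ₗ[F] F)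
    (hq : ∀ a, x a * w a + y a * z a = 0)
    (hinj : ∀ a, x a = 0 → y a = 0 → z a = 0 → w a = 0 → a = 0) : False := by
  -- polarisation (characteristic-free)
  have hpol : ∀ a b, x a * w b + x b * w a + y a * z b + y b * z a = 0 := by
    intro a b
    have h := hq (a + b)
    simp only [map_add] at h
    linear_combination h - hq a - hq b
  -- two linear forms on `Fⁿ`, `n ≥ 3`, have a common non-trivial zero
  have hker : ∀ f g : (ι → F) →ₗ[F] F, ∃ a, a ≠ 0 ∧ f a = 0 ∧ g a = 0 := by
    intro f g
    by_contra h
    push Not at h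
    have hinj' : Function.Injective (f.prod g) := by
      intro a b hab
      obtain ⟨h₁, h₂⟩ := Prod.mk.inj (show (f a, g a) = (f b, g b) from hab)
      by_contra hne
      exact h (a - b) (sub_ne_zero.2 hne) (by rw [map_sub, h₁, sub_self])
        (by rw [map_sub, h₂, sub_self])
    have hle := LinearMap.finrank_le_finrank_of_injective hinj'
    rw [Module.finrank_fintype_fun_eq_card, Module.finrank_prod, Module.finrank_self] at hle
    omega
  obtain ⟨a₁, ha₁, hx₁, hy₁⟩ := hker x y
  obtain ⟨a₂, ha₂, hz₂, hw₂⟩ := hker z w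
  have h1 : ∀ b, x b * w a₁ + y b * z a₁ = 0 := fun b => by
    have h := hpol a₁ b
    rw [hx₁, hy₁] at h
    linear_combination h
  have h2 : ∀ b, x a₂ * w b + y a₂ * z b = 0 := fun b => by
    have h := hpol a₂ b
    rw [hz₂, hw₂] at h
    linear_combination h
  have hzw₁ : z a₁ ≠ 0 ∨ w a₁ ≠ 0 := by
    by_contra h
    push Not at h
    exact ha₁ (hinj a₁ hx₁ hy₁ h.1 h.2)
  have hxy₂ : x a₂ ≠ 0 ∨ y a₂ ≠ 0 := by
    by_contra h
    push Not at h
    exact ha₂ (hinj a₂ h.1 h.2 hz₂ hw₂)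
  -- one of `x, y` determines both; one of `z, w` determines both
  have e1 : ∃ μ₁ : (ι → F) →ₗ[F] F, ∀ b, μ₁ b = 0 → x b = 0 ∧ y b = 0 := by
    by_cases hw : w a₁ = 0
    · have hz : z a₁ ≠ 0 := hzw₁.resolve_right (fun h => h hw)
      refine ⟨x, fun b hb => ⟨hb, ?_⟩⟩
      have h := h1 b
      rw [hw, mul_zero, zero_add] at h
      exact (mul_eq_zero.1 h).resolve_right hz
    · refine ⟨y, fun b hb => ⟨?_, hb⟩⟩
      have h := h1 b
      rw [hb, zero_mul, add_zero] at h
      exact (mul_eq_zero.1 h).resolve_right hw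
  have e2 : ∃ μ₂ : (ι → F) →ₗ[F] F, ∀ b, μ₂ b = 0 → z b = 0 ∧ w b = 0 := by
    by_cases hx : x a₂ = 0
    · have hy : y a₂ ≠ 0 := hxy₂.resolve_left (fun h => h hx)
      refine ⟨w, fun b hb => ⟨?_, hb⟩⟩
      have h := h2 b
      rw [hx, zero_mul, zero_add] at h
      exact (mul_eq_zero.1 h).resolve_left hy
    · refine ⟨z, fun b hb => ⟨hb, ?_⟩⟩
      have h := h2 b
      rw [hb, mul_zero, add_zero] at h
      exact (mul_eq_zero.1 h).resolve_left hx
  obtain ⟨μ₁, hμ₁⟩ := e1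
  obtain ⟨μ₂, hμ₂⟩ := e2
  obtain ⟨a, ha, h1a, h2a⟩ := hker μ₁ μ₂
  exact ha (hinj a (hμ₁ a h1a).1 (hμ₁ a h1a).2 (hμ₂ a h2a).1 (hμ₂ a h2a).2)

/-- **The image of a row space lies in a row space or in a column space** (Botta, §2: for a
permanent preserver `T` of `M_n(F)`, `n ≥ 3`, "`T(Rⁱ) = U` … must be a subspace of some `Rʲ` or
`C_j`"). Every `T (row p := a)` is an affine direction of `per` (transport of row-linearity
through the bijection `T`), hence has vanishing `2 × 2` subpermanents (Lemma 2) and one of the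
three forms of Lemma 3; a generic `a` (largest support) decides the form for all `a`, and form
(2) would embed `Fⁿ` in the cone `xw + yz = 0` of `F⁴` (`not_isotropic`).
[cite: Botta1967, §2, proof of the Theorem] -/
theorem image_row_subset_row_or_col [Infinite F] (h2 : (2 : F) ≠ 0) (hn : 3 ≤ Fintype.card ι)
    (T : Matrix ι ι F →ₗ[F] Matrix ι ι F) (hT : ∀ X, (T X).permanent = X.permanent) (p : ι) :
    (∃ r, ∀ (a : ι → F) (s c : ι), s ≠ r → T ((0 : Matrix ι ι F).updateRow p a) s c = 0) ∨
    (∃ k, ∀ (a : ι → F) (s c : ι), c ≠ k → T ((0 : Matrix ι ι F).updateRow p a) s c = 0) := by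
  classical
  have hne : Nonempty ι := Fintype.card_pos_iff.1 (by omega)
  have hinj : Function.Injective T := injective_of_permanent_eq T hT
  have hsurj : Function.Surjective T := LinearMap.injective_iff_surjective.1 hinj
  obtain ⟨R, hR⟩ := exists_rowLinearMap (F := F) p
  -- every `T (row a)` has vanishing `2 × 2` subpermanents
  have hZ : ∀ (a : ι → F) (i j k l : ι), i ≠ j → k ≠ l →
      T (R a) i k * T (R a) j l + T (R a) i l * T (R a) j k = 0 := by
    intro a i j k l hij hkl
    refine subperm_eq_zero_of_affine (A := T (R a)) (fun X z => ?_) hij hkl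
    exact affine_map_of_affine T hT hsurj
      (fun X z => by rw [hR]; exact permanent_add_smul_row X p a z) X z
  obtain ⟨a₀, ha₀⟩ := exists_generic_support (T.comp R)
  simp only [LinearMap.comp_apply] at ha₀
  rcases support_of_subperm_eq_zero h2 (hZ a₀) with
    ⟨r, hr⟩ | ⟨k, hk⟩ | ⟨i, j, k, l, hij, hkl, -, -, hblock⟩
  · left
    refine ⟨r, fun a s c hs => ?_⟩
    rw [← hR]
    by_contra h
    exact ha₀ a s c h (hr s c hs)
  · right
    refine ⟨k, fun a s c hc => ?_⟩
    rw [← hR]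
    by_contra h
    exact ha₀ a s c h (hk s c hc)
  · exfalso
    have hsupp : ∀ a s c, ¬((s = i ∨ s = j) ∧ (c = k ∨ c = l)) → T (R a) s c = 0 := by
      intro a s c hsc
      by_contra h
      exact hsc (hblock s c (ha₀ a s c h))
    refine not_isotropic hn
      ((Matrix.entryLinearMap F F i k).comp (T.comp R))
      ((Matrix.entryLinearMap F F i l).comp (T.comp R))
      ((Matrix.entryLinearMap F F j k).comp (T.comp R))
      ((Matrix.entryLinearMap F F j l).comp (T.comp R))
      (fun a => by simpa using hZ a i j k l hij hkl) (fun a hx hy hz hw => ?_)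
    simp only [LinearMap.comp_apply, Matrix.entryLinearMap_apply] at hx hy hz hw
    have hTa : T (R a) = 0 := by
      ext s c
      rw [Matrix.zero_apply]
      by_cases hsc : (s = i ∨ s = j) ∧ (c = k ∨ c = l)
      · rcases hsc with ⟨rfl | rfl, rfl | rfl⟩ <;> assumption
      · exact hsupp a s c hsc
    have hRa : R a = 0 := hinj (by rw [hTa, map_zero])
    funext c
    have h := congr_fun (congr_fun hRa p) c
    rw [hR, updateRow_self] at h
    exact h

/-- The column version of `image_row_subset_row_or_col` (apply it to `X ↦ T Xᵀ`).
[cite: Botta1967, §2, proof of the Theorem] -/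
theorem image_col_subset_row_or_col [Infinite F] (h2 : (2 : F) ≠ 0) (hn : 3 ≤ Fintype.card ι)
    (T : Matrix ι ι F →ₗ[F] Matrix ι ι F) (hT : ∀ X, (T X).permanent = X.permanent) (q : ι) :
    (∃ r, ∀ (a : ι → F) (s c : ι), s ≠ r → T ((0 : Matrix ι ι F).updateCol q a) s c = 0) ∨
    (∃ k, ∀ (a : ι → F) (s c : ι), c ≠ k → T ((0 : Matrix ι ι F).updateCol q a) s c = 0) := by
  let T' : Matrix ι ι F →ₗ[F] Matrix ι ι F :=
    T.comp (Matrix.transposeLinearEquiv ι ι F F).toLinearMap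
  have hT'X : ∀ X, T' X = T Xᵀ := fun X => rfl
  have hT' : ∀ X, (T' X).permanent = X.permanent := fun X => by
    rw [hT'X, hT, permanent_transpose]
  have key : ∀ a, T' ((0 : Matrix ι ι F).updateRow q a) = T ((0 : Matrix ι ι F).updateCol q a) :=
    fun a => by rw [hT'X, ← updateCol_transpose, transpose_zero]
  rcases image_row_subset_row_or_col h2 hn T' hT' q with ⟨r, hr⟩ | ⟨k, hk⟩
  · exact Or.inl ⟨r, fun a s c hs => by rw [← key]; exact hr a s c hs⟩
  · exact Or.inr ⟨k, fun a s c hc => by rw [← key]; exact hk a s c hc⟩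

end Structure


/-! ### Botta's §2, conclusion: the monomial sandwich -/

section Sandwich

variable {F : Type*} [Field F]

omit [Fintype ι] in
/-- The matrix unit `E_pq` is a row-`p` matrix and a column-`q` matrix. [folklore] -/
private theorem updateRow_single_eq_updateCol_single (p q : ι) (x : F) :
    (0 : Matrix ι ι F).updateRow p (Pi.single q x) =
      (0 : Matrix ι ι F).updateCol q (Pi.single p x) := by
  rw [← Matrix.single_eq_updateRow_zero, ← Matrix.single_eq_updateCol_zero]

omit [Fintype ι] in
/-- Entries of a permutation matrix (orientation of `Equiv.Perm.permMatrix`). [folklore] -/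
private theorem permMatrix_apply' (μ : Equiv.Perm ι) (s c : ι) :
    μ.permMatrix F s c = if μ s = c then 1 else 0 := by
  show μ.toPEquiv.toMatrix s c = _
  rw [PEquiv.toMatrix_toPEquiv_apply, Pi.single_apply]
  rcases eq_or_ne (μ s) c with h | h
  · rw [if_pos h.symm, if_pos h]
  · rw [if_neg (Ne.symm h), if_neg h]

/-- Entries of a monomial sandwich `D P_π X P_ρ L`. [folklore] -/
private theorem sandwich_apply (d l : ι → F) (π ρ : Equiv.Perm ι) (X : Matrix ι ι F) (s c : ι) :
    (diagonal d * π.permMatrix F * X * ρ.permMatrix F * diagonal l) s c =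
      d s * X (π s) (ρ.symm c) * l c := by
  have h1 : diagonal d * π.permMatrix F * X * ρ.permMatrix F * diagonal l =
      diagonal d * ((X.submatrix π id).submatrix id ρ.symm) * diagonal l := by
    rw [Matrix.mul_assoc (diagonal d), PEquiv.toMatrix_toPEquiv_mul, Matrix.mul_assoc (diagonal d),
      PEquiv.mul_toMatrix_toPEquiv]
  rw [h1, Matrix.mul_diagonal, Matrix.diagonal_mul, Matrix.submatrix_apply, Matrix.submatrix_apply]
  rfl

/-- **Botta's §2, conclusion, in the case "rows to rows".** If a permanent preserver `T` of
`M_n(F)` (`n ≥ 3`, `F` infinite, `char F ≠ 2`) maps every row space into a row space,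
`T(Rᵖ) ⊆ R^{σ p}`, then: `σ` is injective (each `T|Rᵖ : Rᵖ → R^{σ p}` is onto), every column
space goes into a column space `T(C_q) ⊆ C_{τ q}` (a row target is excluded by
`T(E_pq) ∈ R^{σ p} ∩ R^{r}`), `T(E_pq) = b_pq E_{σ p, τ q}`, the permutation matrices give
`∏_p b_{p, μ p} = per (T P_μ) = 1` for every permutation `μ`, whence
`b_pq b_p'q' = b_pq' b_p'q`, `b_pq = d_p l_q` and `(∏ d)(∏ l) = 1`: `T X = D P X Q L`
(Marcus–May's normal form (2.3); the factorisation step is verbatim Botta's, p. 569: "By choosing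
`X` to be an appropriate permutation matrix we find that for each `μ ∈ S_m`, `∏ b_{iμ(i)} = 1` …
`a_i = b_i1/b_11; c_j = b_1j`"). [cite: Botta1967, §2, proof of the Theorem, pp. 568–569]
[cite: MarcusMay1962, §2, Theorem, (2.3); §3, Lemmas 8–9] -/
theorem exists_sandwich_of_rows_to_rows [Infinite F] (h2 : (2 : F) ≠ 0)
    (hn : 3 ≤ Fintype.card ι) (T : Matrix ι ι F →ₗ[F] Matrix ι ι F)
    (hT : ∀ X, (T X).permanent = X.permanent) (σ : ι → ι)
    (hσ : ∀ (p : ι) (a : ι → F) (s c : ι), s ≠ σ p →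
      T ((0 : Matrix ι ι F).updateRow p a) s c = 0) :
    ∃ (π ρ : Equiv.Perm ι) (d l : ι → F), (∏ i, d i) * (∏ i, l i) = 1 ∧
      ∀ X, T X = diagonal d * π.permMatrix F * X * ρ.permMatrix F * diagonal l := by
  classical
  have hne : Nonempty ι := Fintype.card_pos_iff.1 (by omega)
  have hinj : Function.Injective T := injective_of_permanent_eq T hT
  have hT0 : ∀ A : Matrix ι ι F, T A = 0 → A = 0 := fun A h => hinj (by rw [h, map_zero])
  -- (1) every row-`σ p` matrix is some `T (row p := a)`; hence `σ` is injective
  have hrow : ∀ (p : ι) (B : Matrix ι ι F), (∀ s c, s ≠ σ p → B s c = 0) →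
      ∃ a, T ((0 : Matrix ι ι F).updateRow p a) = B := by
    intro p B hB
    obtain ⟨R, hR⟩ := exists_rowLinearMap (F := F) p
    have hΦ : Function.Injective (T.comp R) := by
      intro a b hab
      have h : R a = R b := hinj hab
      rw [hR, hR] at h
      funext c
      have := congr_fun (congr_fun h p) c
      rwa [updateRow_self, updateRow_self] at this
    obtain ⟨a, ha⟩ := exists_eq_of_supported (T.comp R) hΦ (fun x => (σ p, x))
      (fun a r c hrc => by
        rw [LinearMap.comp_apply, hR]
        exact hσ p a r c (fun h => hrc c (by rw [h])))
      B (fun r c hrc => hB r c (fun h => hrc c (by rw [h])))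
    exact ⟨a, by rw [← hR]; exact ha⟩
  have hσinj : Function.Injective σ := by
    intro p p' hpp
    by_contra hne'
    obtain ⟨a, ha⟩ := hrow p (T ((0 : Matrix ι ι F).updateRow p' fun _ => 1))
      (fun s c hs => hσ p' _ s c (by rwa [← hpp]))
    have h := congr_fun (congr_fun (hinj ha) p') p'
    rw [updateRow_ne (Ne.symm hne'), updateRow_self, Matrix.zero_apply] at h
    simp at h
  -- (2) columns go to columns
  have hcol : ∀ q, ∃ k, ∀ (a : ι → F) (s c : ι), c ≠ k →
      T ((0 : Matrix ι ι F).updateCol q a) s c = 0 := by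
    intro q
    rcases image_col_subset_row_or_col h2 hn T hT q with ⟨r, hr⟩ | hk
    · exfalso
      -- every `σ p` equals `r`: `T (E_pq) ≠ 0` lies in the rows `σ p` and `r`
      have hall : ∀ p, σ p = r := by
        intro p
        by_contra hpr
        have hE : T ((0 : Matrix ι ι F).updateRow p (Pi.single q 1)) = 0 := by
          ext s c
          rw [Matrix.zero_apply]
          by_cases hs : s = σ p
          · rw [updateRow_single_eq_updateCol_single]
            exact hr _ s c (by rw [hs]; exact hpr)
          · exact hσ p _ s c hs
        have h := congr_fun (congr_fun (hT0 _ hE) p) q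
        rw [updateRow_self, Matrix.zero_apply] at h
        simp at h
      obtain ⟨p₁, p₂, hp⟩ := Fintype.exists_pair_of_one_lt_card (α := ι) (by omega)
      exact hp (hσinj ((hall p₁).trans (hall p₂).symm))
    · exact hk
  choose τ hτ using hcol
  -- (3) every column-`τ q` matrix is some `T (col q := a)`; hence `τ` is injective
  have hcolsurj : ∀ (q : ι) (B : Matrix ι ι F), (∀ s c, c ≠ τ q → B s c = 0) →
      ∃ a, T ((0 : Matrix ι ι F).updateCol q a) = B := by
    intro q B hB
    obtain ⟨C, hC⟩ : ∃ C : (ι → F) →ₗ[F] Matrix ι ι F,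
        ∀ a, C a = (0 : Matrix ι ι F).updateCol q a := by
      obtain ⟨R, hR⟩ := exists_rowLinearMap (F := F) q
      refine ⟨(Matrix.transposeLinearEquiv ι ι F F).toLinearMap.comp R, fun a => ?_⟩
      show (R a)ᵀ = _
      rw [hR, ← updateCol_transpose, transpose_zero]
    have hΦ : Function.Injective (T.comp C) := by
      intro a b hab
      have h : C a = C b := hinj hab
      rw [hC, hC] at h
      funext s
      have := congr_fun (congr_fun h s) q
      rwa [updateCol_self, updateCol_self] at this
    obtain ⟨a, ha⟩ := exists_eq_of_supported (T.comp C) hΦ (fun x => (x, τ q))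
      (fun a r c hrc => by
        rw [LinearMap.comp_apply, hC]
        exact hτ q a r c (fun h => hrc r (by rw [h])))
      B (fun r c hrc => hB r c (fun h => hrc r (by rw [h])))
    exact ⟨a, by rw [← hC]; exact ha⟩
  have hτinj : Function.Injective τ := by
    intro q q' hqq
    by_contra hne'
    obtain ⟨a, ha⟩ := hcolsurj q (T ((0 : Matrix ι ι F).updateCol q' fun _ => 1))
      (fun s c hc => hτ q' _ s c (by rwa [← hqq]))
    have h := congr_fun (congr_fun (hinj ha) q') q'
    rw [updateCol_ne (Ne.symm hne'), updateCol_self, Matrix.zero_apply] at h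
    simp at h
  -- (4) the permutations and the coefficients `b p q := T(E_pq)_{σ p, τ q}`
  obtain ⟨π₀, hπ₀⟩ : ∃ π₀ : Equiv.Perm ι, ∀ p, π₀ p = σ p :=
    ⟨Equiv.ofBijective σ (Finite.injective_iff_bijective.1 hσinj), fun p => rfl⟩
  obtain ⟨ρ₀, hρ₀⟩ : ∃ ρ₀ : Equiv.Perm ι, ∀ q, ρ₀ q = τ q :=
    ⟨Equiv.ofBijective τ (Finite.injective_iff_bijective.1 hτinj), fun q => rfl⟩
  set b : ι → ι → F := fun p q =>
    T ((0 : Matrix ι ι F).updateRow p (Pi.single q 1)) (σ p) (τ q) with hb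
  have hE : ∀ p q s c, T ((0 : Matrix ι ι F).updateRow p (Pi.single q 1)) s c =
      if s = σ p ∧ c = τ q then b p q else 0 := by
    intro p q s c
    split_ifs with h
    · rw [h.1, h.2]
    · by_cases hs : s = σ p
      · have hc : c ≠ τ q := fun hc => h ⟨hs, hc⟩
        rw [updateRow_single_eq_updateCol_single]
        exact hτ q _ s c hc
      · exact hσ p _ s c hs
  have hb0 : ∀ p q, b p q ≠ 0 := by
    intro p q h0
    have hE0 : T ((0 : Matrix ι ι F).updateRow p (Pi.single q 1)) = 0 := by
      ext s c
      rw [hE, Matrix.zero_apply]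
      by_cases h' : s = σ p ∧ c = τ q
      · rw [if_pos h']; exact h0
      · rw [if_neg h']
    have h := congr_fun (congr_fun (hT0 _ hE0) p) q
    rw [updateRow_self, Matrix.zero_apply] at h
    simp at h
  -- (5) the entries of `T X`
  have hdecomp : ∀ X : Matrix ι ι F,
      X = ∑ p, ∑ q, X p q • (0 : Matrix ι ι F).updateRow p (Pi.single q 1) := by
    intro X
    conv_lhs => rw [Matrix.matrix_eq_sum_single X]
    refine Finset.sum_congr rfl fun p _ => Finset.sum_congr rfl fun q _ => ?_
    rw [← Matrix.single_eq_updateRow_zero, Matrix.smul_single, smul_eq_mul, mul_one]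
  have hTX : ∀ X s c, T X s c = X (π₀.symm s) (ρ₀.symm c) * b (π₀.symm s) (ρ₀.symm c) := by
    intro X s c
    conv_lhs => rw [hdecomp X]
    simp only [map_sum, map_smul, Matrix.sum_apply, Matrix.smul_apply, smul_eq_mul, hE]
    rw [Finset.sum_eq_single (π₀.symm s)]
    · rw [Finset.sum_eq_single (ρ₀.symm c)]
      · have h1 : s = σ (π₀.symm s) := by rw [← hπ₀, Equiv.apply_symm_apply]
        have h2 : c = τ (ρ₀.symm c) := by rw [← hρ₀, Equiv.apply_symm_apply]
        rw [if_pos ⟨h1, h2⟩]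
      · intro q _ hq
        rw [if_neg, mul_zero]
        rintro ⟨-, hc⟩
        exact hq (by rw [hc, ← hρ₀, Equiv.symm_apply_apply])
      · intro h; exact absurd (Finset.mem_univ _) h
    · intro p _ hp
      refine Finset.sum_eq_zero fun q _ => ?_
      rw [if_neg, mul_zero]
      rintro ⟨hs, -⟩
      exact hp (by rw [hs, ← hπ₀, Equiv.symm_apply_apply])
    · intro h; exact absurd (Finset.mem_univ _) h
  -- (6) permutation matrices: `∏_p b_{p, μ p} = per (T P_μ) = per P_μ = 1`
  have hperm : ∀ μ : Equiv.Perm ι, ∏ p, b p (μ p) = 1 := by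
    intro μ
    set ν : Equiv.Perm ι := (π₀.symm.trans μ).trans ρ₀ with hν
    have hTP : T (μ.permMatrix F) =
        diagonal (fun s => b (π₀.symm s) (μ (π₀.symm s))) * ν.permMatrix F := by
      ext s c
      rw [hTX, Matrix.diagonal_mul, permMatrix_apply', permMatrix_apply', hν, Equiv.trans_apply,
        Equiv.trans_apply]
      by_cases h : μ (π₀.symm s) = ρ₀.symm c
      · have h' : ρ₀ (μ (π₀.symm s)) = c := by rw [h, Equiv.apply_symm_apply]
        rw [if_pos h, if_pos h', ← h, one_mul, mul_one]
      · have h' : ¬ρ₀ (μ (π₀.symm s)) = c := fun h' => h (by rw [← h', Equiv.symm_apply_apply])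
        rw [if_neg h, if_neg h', zero_mul, mul_zero]
    have h1 : (T (μ.permMatrix F)).permanent = 1 := by
      rw [hT, ← Matrix.mul_one (μ.permMatrix F), permanent_permMatrix_mul, permanent_one]
    rw [hTP, permanent_diagonal_mul, ← Matrix.mul_one (ν.permMatrix F), permanent_permMatrix_mul,
      permanent_one, mul_one] at h1
    rw [← h1]
    exact (Equiv.prod_comp π₀.symm (fun p => b p (μ p))).symm
  -- (7) `b_pq b_p'q' = b_pq' b_p'q`
  have hswap : ∀ p p' q q', p ≠ p' → q ≠ q' → b p q * b p' q' = b p q' * b p' q := by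
    intro p p' q q' hpp hqq
    obtain ⟨μ, hμp, hμp'⟩ : ∃ μ : Equiv.Perm ι, μ p = q ∧ μ p' = q' := by
      have ht : Equiv.swap p q p' ≠ q := by
        intro h
        have h' := congr_arg (Equiv.swap p q) h
        rw [Equiv.swap_apply_self, Equiv.swap_apply_right] at h'
        exact hpp h'.symm
      refine ⟨(Equiv.swap p q).trans (Equiv.swap (Equiv.swap p q p') q'), ?_, ?_⟩
      · rw [Equiv.trans_apply, Equiv.swap_apply_left, Equiv.swap_apply_of_ne_of_ne ht.symm hqq]
      · rw [Equiv.trans_apply, Equiv.swap_apply_left]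
    have e1 := hperm μ
    have e2 := hperm ((Equiv.swap p p').trans μ)
    rw [← Finset.mul_prod_erase _ _ (Finset.mem_univ p),
      ← Finset.mul_prod_erase _ _ (Finset.mem_erase.2 ⟨Ne.symm hpp, Finset.mem_univ p'⟩)] at e1 e2
    simp only [Equiv.trans_apply, Equiv.swap_apply_left, Equiv.swap_apply_right, hμp, hμp']
      at e1 e2
    have hR : ∏ x ∈ (Finset.univ.erase p).erase p', b x (μ (Equiv.swap p p' x)) =
        ∏ x ∈ (Finset.univ.erase p).erase p', b x (μ x) := by
      refine Finset.prod_congr rfl fun x hx => ?_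
      have hx' : x ≠ p' := Finset.ne_of_mem_erase hx
      have hx : x ≠ p := Finset.ne_of_mem_erase (Finset.mem_of_mem_erase hx)
      rw [Equiv.swap_apply_of_ne_of_ne hx hx']
    rw [hR] at e2
    have hR0 : ∏ x ∈ (Finset.univ.erase p).erase p', b x (μ x) ≠ 0 := fun h => by
      rw [h, mul_zero, mul_zero] at e1
      exact zero_ne_one e1
    apply mul_right_cancel₀ hR0
    linear_combination e1 - e2
  -- (8) `b_pq = d_p l_q`, `(∏ d)(∏ l) = 1`
  obtain ⟨p₀⟩ := hne
  have h00 : b p₀ p₀ ≠ 0 := hb0 p₀ p₀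
  set d' : ι → F := fun p => b p p₀ / b p₀ p₀ with hd'
  set l' : ι → F := fun q => b p₀ q with hl'
  have hfac : ∀ p q, b p q = d' p * l' q := by
    intro p q
    simp only [hd', hl']
    by_cases hp : p = p₀
    · rw [hp, div_self h00, one_mul]
    · by_cases hq : q = p₀
      · rw [hq, div_mul_cancel₀ _ h00]
      · rw [div_mul_eq_mul_div, eq_div_iff h00]
        exact hswap p p₀ q p₀ hp hq
  have hdl : (∏ p, d' p) * (∏ q, l' q) = 1 := by
    rw [← Finset.prod_mul_distrib]
    have h := hperm 1
    simp only [Equiv.Perm.coe_one, id_eq] at h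
    exact (Finset.prod_congr rfl fun p _ => (hfac p p).symm).trans h
  refine ⟨π₀.symm, ρ₀, fun s => d' (π₀.symm s), fun c => l' (ρ₀.symm c), ?_, fun X => ?_⟩
  · show (∏ i, d' (π₀.symm i)) * (∏ i, l' (ρ₀.symm i)) = 1
    rw [Equiv.prod_comp π₀.symm d', Equiv.prod_comp ρ₀.symm l']
    exact hdl
  · ext s c
    rw [sandwich_apply, hTX, hfac]
    ring

/-- **The Marcus–May / Botta theorem over a field** (linear permanent preservers of `M_n(F)`,
`n ≥ 3`, `F` infinite with `2 ≠ 0`): `T` is a monomial sandwich `X ↦ D P_π X P_ρ L` or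
`X ↦ D P_π Xᵀ P_ρ L` with `(∏ d)(∏ l) = 1`. Botta's §2: each `T(Rᵖ)` lies in a row or a column
space (`image_row_subset_row_or_col`); a row target for one `p` and a column target for another
are incompatible (the line `F E_{rk}` would lie in both images of the injective `T`); if all row
spaces go to row spaces we are in `exists_sandwich_of_rows_to_rows`, otherwise all go to column
spaces and `X ↦ (T X)ᵀ` is of the first kind. [cite: Botta1967, §2, Theorem]
[cite: MarcusMay1962, §2, Theorem, (2.3)–(2.4)] -/
theorem exists_sandwich_of_permanent_eq [Infinite F] (h2 : (2 : F) ≠ 0)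
    (hn : 3 ≤ Fintype.card ι) (T : Matrix ι ι F →ₗ[F] Matrix ι ι F)
    (hT : ∀ X, (T X).permanent = X.permanent) :
    ∃ (π ρ : Equiv.Perm ι) (d l : ι → F), (∏ i, d i) * (∏ i, l i) = 1 ∧
      ((∀ X, T X = diagonal d * π.permMatrix F * X * ρ.permMatrix F * diagonal l) ∨
       (∀ X, T X = diagonal d * π.permMatrix F * Xᵀ * ρ.permMatrix F * diagonal l)) := by
  classical
  have hinj : Function.Injective T := injective_of_permanent_eq T hT
  by_cases hrows : ∀ p, ∃ r, ∀ (a : ι → F) (s c : ι), s ≠ r →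
      T ((0 : Matrix ι ι F).updateRow p a) s c = 0
  · choose σ hσ using hrows
    obtain ⟨π, ρ, d, l, hdl, h⟩ := exists_sandwich_of_rows_to_rows h2 hn T hT σ hσ
    exact ⟨π, ρ, d, l, hdl, Or.inl h⟩
  · push Not at hrows
    obtain ⟨p₂, hp₂⟩ := hrows
    obtain ⟨k₂, hk₂⟩ : ∃ k, ∀ (a : ι → F) (s c : ι), c ≠ k →
        T ((0 : Matrix ι ι F).updateRow p₂ a) s c = 0 := by
      rcases image_row_subset_row_or_col h2 hn T hT p₂ with ⟨r, hr⟩ | hk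
      · obtain ⟨a, s, c, hs, hne'⟩ := hp₂ r
        exact absurd (hr a s c hs) hne'
      · exact hk
    -- injectivity of `a ↦ T (row p := a)`
    have hΦ : ∀ (p : ι) (R : (ι → F) →ₗ[F] Matrix ι ι F),
        (∀ a, R a = (0 : Matrix ι ι F).updateRow p a) → Function.Injective (T.comp R) := by
      intro p R hR a b hab
      have h : R a = R b := hinj hab
      rw [hR, hR] at h
      funext c
      have := congr_fun (congr_fun h p) c
      rwa [updateRow_self, updateRow_self] at this
    -- all row spaces go to column spaces
    have hcols : ∀ p, ∃ k, ∀ (a : ι → F) (s c : ι), c ≠ k →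
        T ((0 : Matrix ι ι F).updateRow p a) s c = 0 := by
      intro p
      rcases image_row_subset_row_or_col h2 hn T hT p with ⟨r, hr⟩ | hk
      · exfalso
        have hpp : p ≠ p₂ := by
          rintro rfl
          obtain ⟨a, s, c, hs, hne'⟩ := hp₂ r
          exact hne' (hr a s c hs)
        -- `E_{r k₂}` is both `T (row p := a)` and `T (row p₂ := a')`
        obtain ⟨R, hR⟩ := exists_rowLinearMap (F := F) p
        obtain ⟨R₂, hR₂⟩ := exists_rowLinearMap (F := F) p₂
        obtain ⟨a, ha⟩ := exists_eq_of_supported (T.comp R) (hΦ p R hR) (fun x => (r, x))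
          (fun a s c hsc => by
            rw [LinearMap.comp_apply, hR]
            exact hr a s c (fun h => hsc c (by rw [h])))
          (Matrix.single r k₂ (1 : F))
          (fun s c hsc => Matrix.single_apply_of_row_ne (fun h => hsc c (by rw [h])) _ _ _)
        obtain ⟨a', ha'⟩ := exists_eq_of_supported (T.comp R₂) (hΦ p₂ R₂ hR₂) (fun x => (x, k₂))
          (fun a s c hsc => by
            rw [LinearMap.comp_apply, hR₂]
            exact hk₂ a s c (fun h => hsc s (by rw [h])))
          (Matrix.single r k₂ (1 : F))
          (fun s c hsc => Matrix.single_apply_of_col_ne _ _ (fun h => hsc s (by rw [h])) _)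
        rw [LinearMap.comp_apply] at ha ha'
        have h := hinj (ha.trans ha'.symm)
        rw [hR, hR₂] at h
        have ha0 : a = 0 := by
          funext c
          have := congr_fun (congr_fun h p) c
          rwa [updateRow_self, updateRow_ne hpp, Matrix.zero_apply] at this
        rw [ha0, map_zero, map_zero] at ha
        have h1 := congr_fun (congr_fun ha r) k₂
        rw [Matrix.zero_apply, Matrix.single_apply_same] at h1
        exact zero_ne_one h1
      · exact hk
    choose κ hκ using hcols
    -- `X ↦ (T X)ᵀ` is rows-to-rows
    let T' : Matrix ι ι F →ₗ[F] Matrix ι ι F :=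
      (Matrix.transposeLinearEquiv ι ι F F).toLinearMap.comp T
    have hT'X : ∀ X, T' X = (T X)ᵀ := fun X => rfl
    have hT' : ∀ X, (T' X).permanent = X.permanent := fun X => by
      rw [hT'X, permanent_transpose, hT]
    have hσ' : ∀ (p : ι) (a : ι → F) (s c : ι), s ≠ κ p →
        T' ((0 : Matrix ι ι F).updateRow p a) s c = 0 :=
      fun p a s c hs => by rw [hT'X, transpose_apply]; exact hκ p a c s hs
    obtain ⟨π, ρ, d, l, hdl, h⟩ := exists_sandwich_of_rows_to_rows h2 hn T' hT' κ hσ'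
    refine ⟨ρ⁻¹, π⁻¹, l, d, by rw [mul_comm]; exact hdl, Or.inr fun X => ?_⟩
    have hX : T X = (T' X)ᵀ := by rw [hT'X, transpose_transpose]
    rw [hX, h X, transpose_mul, transpose_mul, transpose_mul, transpose_mul, diagonal_transpose,
      diagonal_transpose, transpose_permMatrix, transpose_permMatrix, ← Matrix.mul_assoc,
      ← Matrix.mul_assoc, ← Matrix.mul_assoc]

end Sandwich

end MarcusMay

/-! ## The discharge of `marcusMay1962_perPreserver_sandwich` -/

section Discharge

open MvPolynomial in
/-- Evaluating a linear substitute: `(linSubst M f)(x) = f(Mᵀ x)` (copy of the private lemma of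
`PerStabilizerMarcusMay.lean`). [folklore] -/
private theorem MarcusMay.eval_linSubst' {σ : Type*} [Fintype σ] (M : Matrix σ σ ℂ) (x : σ → ℂ)
    (f : MvPolynomial σ ℂ) : eval x (linSubst σ ℂ M f) = eval (Mᵀ *ᵥ x) f := by
  induction f using MvPolynomial.induction_on with
  | C a => rw [linSubst_C, eval_C, eval_C]
  | add p q hp hq => rw [map_add, map_add, map_add, hp, hq]
  | mul_X p i hp =>
    rw [map_mul, map_mul, map_mul, hp, linSubst_X, eval_X]
    congr 1
    simp [Matrix.mulVec, dotProduct, smul_eval]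

/-- **Discharge of `marcusMay1962_perPreserver_sandwich`** (Marcus–May 1962, §2 Theorem with
remark (2.7); proof after Botta 1967): for `n ≥ 3`, a matrix `M` over `Fin n × Fin n` whose
linear substitution fixes the generic permanent acts on `M_n(ℂ)`, `X ↦ mat(Mᵀ · vec X)`, as a
linear permanent preserver (evaluate the polynomial identity), to which
`MarcusMay.exists_sandwich_of_permanent_eq` applies (`ℂ` is infinite of characteristic `0`).
[cite: MarcusMay1962, §2 Theorem (2.3)–(2.4) and remark (2.7), p. 179]
[cite: Botta1967, §2, Theorem] -/
theorem marcusMay1962_perPreserver_sandwich_holds : marcusMay1962_perPreserver_sandwich := by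
  intro n hn M hM
  let T : Matrix (Fin n) (Fin n) ℂ →ₗ[ℂ] Matrix (Fin n) (Fin n) ℂ :=
    { toFun := fun X => Matrix.of fun a b => (Mᵀ *ᵥ fun p => X p.1 p.2) (a, b)
      map_add' := by
        intro X Y
        ext a b
        simp only [Matrix.add_apply, Matrix.of_apply]
        rw [← Pi.add_apply (Mᵀ *ᵥ _) (Mᵀ *ᵥ _), ← Matrix.mulVec_add]
        rfl
      map_smul' := by
        intro c X
        ext a b
        simp only [Matrix.smul_apply, Matrix.of_apply, RingHom.id_apply, Matrix.mulVec,
          dotProduct, smul_eq_mul, Finset.mul_sum]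
        exact Finset.sum_congr rfl fun p _ => by ring }
  have hTx : ∀ x : Fin n × Fin n → ℂ, T (Matrix.of fun a b => x (a, b)) =
      Matrix.of fun a b => (Mᵀ *ᵥ x) (a, b) := by
    intro x
    have hx : (fun p : Fin n × Fin n => (Matrix.of fun a b => x (a, b)) p.1 p.2) = x := by
      funext p
      simp
    simp only [T, LinearMap.coe_mk, AddHom.coe_mk]
    rw [hx]
  have hT : ∀ X, (T X).permanent = X.permanent := by
    intro X
    have h := congr_arg (MvPolynomial.eval fun p : Fin n × Fin n => X p.1 p.2) hM
    have hX : (Matrix.of fun i j => (fun p : Fin n × Fin n => X p.1 p.2) (i, j)) = X := by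
      ext i j
      simp
    rw [MarcusMay.eval_linSubst', eval_perPoly, eval_perPoly, hX] at h
    exact h
  obtain ⟨π, ρ, d, l, hdl, h⟩ := MarcusMay.exists_sandwich_of_permanent_eq (F := ℂ) two_ne_zero
    (by rw [Fintype.card_fin]; exact hn) T hT
  refine ⟨π, ρ, d, l, hdl, ?_⟩
  rcases h with h | h
  · exact Or.inl fun x => by rw [← hTx, h]
  · exact Or.inr fun x => by rw [← hTx, h]

end Discharge

end Literature.Computability.AlgebraicComplexity
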